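import Mathlib
import Literature.Probability.LatticeModels.TorusTransferSpectral
import HarnessLib

/-!
# The resolvent of the nearest-neighbour walk on the cycle `ℤ/Lℤ`

Topic `Probability/LatticeModels`. For `a > 1` the massive one-dimensional lattice propagator on
the periodic interval `ℤ/Lℤ`,
`R_L(n) = L⁻¹ ∑_{k ∈ ℤ/Lℤ} cos(2πkn/L) / (a - cos(2πk/L))`,
has the closed form (method of images for the two-sided geometric kernel `λ^{|n|}`, i.e. the
transfer-matrix evaluation of the covariance of the Gaussian chain on a ring)
`R_L(n) = 2λ (λⁿ + λ^{L-n}) / ((1 - λ²)(1 - λ^L))`, `0 ≤ n ≤ L`,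
with the mass parameter `λ = a - √(a² - 1) ∈ (0,1)`, `(λ + λ⁻¹)/2 = a`. PROVED here:

* `eq_zero_of_cycle_harmonic` — the discrete maximum principle: `a u = ½(u(·+1) + u(·-1))` on
  `ℤ/Lℤ` with `a > 1` forces `u = 0`;
* `cycle_charSum_resolvent_eq`, `cycle_explicit_resolvent_eq` — the character sum and the
  explicit function `λ^{m.val} + λ^{L-m.val}` solve the same resolvent equation
  `a r(m) - ½(r(m+1) + r(m-1)) = source · 𝟙(m = 0)` (orthogonality of characters, resp. a direct
  computation at the seam `m = 0`);
* `cycle_charSum_resolvent`, `sum_cos_div_sub_cos_cycle` — **the closed form**, in character and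
  in cosine form, parametrised by `λ ∈ (0,1)`;
* `massParam_spec`, `massParam_le`, `exp_neg_le_massParam` — `λ = a - √(a² - 1)`:
  `0 < λ < 1`, `(λ + λ⁻¹)/2 = a`, `2λ/(1 - λ²) = 1/√(a² - 1)`, `λ ≤ 1/(1 + √(a² - 1))`,
  `λ ≥ exp(-((a - 1) + √(a² - 1)))`.

This is the one-dimensional building block of the transverse (layer-by-layer) evaluation of
lattice Green functions on tori (`MaxwellKernelTransverse.lean`). Standard material (transfer
matrix of the Gaussian chain; e.g. Montvay–Münster, *Quantum Fields on a Lattice*, §1.4, or any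
treatment of the lattice Yukawa potential in one dimension); no single source is followed.

Mathlib: the standard additive character `ZMod.stdAddChar` and `AddChar.sum_mulShift`
(orthogonality) are used; the tree's `stdAddChar_re` (`TorusTransferSpectral.lean`) converts to
cosines. Deliberately NOT here: the infinite-volume limit `L → ∞`, complex `a`.
-/

noncomputable section

open Finset Real

namespace Literature.Probability.LatticeModels

variable {L : ℕ}

/-! ### The discrete maximum principle on the cycle -/

/-- **Discrete maximum principle on the cycle.** If `a > 1` and `u : ℤ/Lℤ → ℝ` satisfies
`a u(m) = (u(m+1) + u(m-1))/2` for all `m`, then `u = 0` (look at a point where `|u|` is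
maximal). [folklore] -/
theorem eq_zero_of_cycle_harmonic [NeZero L] {a : ℝ} (ha : 1 < a) (u : ZMod L → ℝ)
    (hu : ∀ m, a * u m = (u (m + 1) + u (m - 1)) / 2) (m : ZMod L) : u m = 0 := by
  obtain ⟨m₀, -, hm₀⟩ := Finset.exists_max_image (univ : Finset (ZMod L)) (fun m => |u m|)
    ⟨0, mem_univ _⟩
  have h1 : a * |u m₀| ≤ |u m₀| := by
    have e : a * |u m₀| = |u (m₀ + 1) + u (m₀ - 1)| / 2 := by
      rw [← abs_of_pos (by linarith : (0 : ℝ) < a), ← abs_mul, hu m₀, abs_div, abs_two]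
    rw [e]
    have h2 := hm₀ (m₀ + 1) (mem_univ _)
    have h3 := hm₀ (m₀ - 1) (mem_univ _)
    have h4 := abs_add_le (u (m₀ + 1)) (u (m₀ - 1))
    linarith
  have h0 : |u m₀| = 0 := by nlinarith [abs_nonneg (u m₀)]
  have h := hm₀ m (mem_univ _)
  rw [h0] at h
  exact abs_eq_zero.1 (le_antisymm h (abs_nonneg _))

/-! ### The standard character of `ℤ/Lℤ` in real form -/

/-- `Re e(k n / L) = cos (2π k.val n / L)` for the standard additive character `e` of `ℤ/Lℤ`
and a natural number `n`. [folklore] -/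
theorem stdAddChar_mul_natCast_re [NeZero L] (k : ZMod L) (n : ℕ) :
    ((ZMod.stdAddChar (k * (n : ZMod L)) : ℂ)).re = Real.cos (2 * π * (k.val : ℝ) / L * n) := by
  have h1 : k * (n : ZMod L) = ((k.val * n : ℤ) : ZMod L) := by
    push_cast
    rw [ZMod.natCast_zmod_val]
  rw [h1, ZMod.stdAddChar_coe]
  have h2 : (2 * π * Complex.I * ((k.val * n : ℤ) : ℂ) / L) =
      ((2 * π * (k.val : ℝ) / L * n : ℝ) : ℂ) * Complex.I := by
    push_cast
    ring
  rw [h2, Complex.exp_ofReal_mul_I_re]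

/-- `Re e(k) ≤ 1`. [folklore] -/
theorem stdAddChar_re_le_one [NeZero L] (k : ZMod L) : ((ZMod.stdAddChar k : ℂ)).re ≤ 1 := by
  rw [stdAddChar_re]
  exact Real.cos_le_one _

/-- The resolvent equation for the character sums: with `c_k = Re e(k)`, `X_k(m) = Re e(k m)`,
`r(m) = ∑_k X_k(m) / (a - c_k)` satisfies `a r(m) - (r(m+1) + r(m-1))/2 = ∑_k X_k(m) = L·𝟙(m = 0)`
(orthogonality of characters). [folklore] -/
theorem cycle_charSum_resolvent_eq [NeZero L] {a : ℝ} (ha : 1 < a) (m : ZMod L) :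
    a * (∑ k : ZMod L, ((ZMod.stdAddChar (k * m) : ℂ)).re / (a - ((ZMod.stdAddChar k : ℂ)).re)) -
      ((∑ k : ZMod L, ((ZMod.stdAddChar (k * (m + 1)) : ℂ)).re / (a - ((ZMod.stdAddChar k : ℂ)).re)) +
        (∑ k : ZMod L, ((ZMod.stdAddChar (k * (m - 1)) : ℂ)).re / (a - ((ZMod.stdAddChar k : ℂ)).re))) / 2 =
      if m = 0 then (L : ℝ) else 0 := by
  classical
  set ψ := (ZMod.stdAddChar : AddChar (ZMod L) ℂ) with hψ
  have hden : ∀ k : ZMod L, a - (ψ k).re ≠ 0 := fun k => by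
    have := stdAddChar_re_le_one k
    rw [← hψ] at this
    intro h
    linarith
  -- the shifted characters
  have hshift : ∀ k : ZMod L, (ψ (k * (m + 1))).re + (ψ (k * (m - 1))).re =
      2 * (ψ k).re * (ψ (k * m)).re := by
    intro k
    rw [mul_add, mul_one, mul_sub, mul_one, AddChar.map_add_eq_mul, sub_eq_add_neg,
      AddChar.map_add_eq_mul, AddChar.map_neg_eq_conj]
    simp only [Complex.mul_re, Complex.conj_re, Complex.conj_im]
    ring
  have hterm : ∀ k : ZMod L, a * ((ψ (k * m)).re / (a - (ψ k).re)) -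
      ((ψ (k * (m + 1))).re / (a - (ψ k).re) + (ψ (k * (m - 1))).re / (a - (ψ k).re)) / 2 =
      (ψ (k * m)).re := by
    intro k
    rw [← add_div, hshift k]
    field_simp [hden k]
  rw [Finset.mul_sum, ← Finset.sum_add_distrib, Finset.sum_div, ← Finset.sum_sub_distrib]
  simp_rw [hterm]
  have hsum : ∑ k : ZMod L, ψ (k * m) = if m = 0 then (L : ℂ) else 0 := by
    rw [AddChar.sum_mulShift m (ZMod.isPrimitive_stdAddChar L), ZMod.card]
    split_ifs <;> simp
  have := congrArg Complex.re hsum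
  rw [Complex.re_sum] at this
  rw [this]
  split_ifs <;> simp

/-! ### The explicit solution `λ^j + λ^{L-j}` -/

/-- Interior points: `a (λ^j + λ^{L-j}) = ½ Σ_± (λ^{j±1} + λ^{L-(j±1)})` for `1 ≤ j ≤ L - 1`, where
`a = (λ + λ⁻¹)/2`. [folklore] -/
theorem cycle_explicit_interior {lam : ℝ} (hl : lam ≠ 0) {j : ℕ} (hj1 : 1 ≤ j) (hjL : j + 1 ≤ L) :
    (lam + lam⁻¹) / 2 * (lam ^ j + lam ^ (L - j)) -
      ((lam ^ (j + 1) + lam ^ (L - (j + 1))) + (lam ^ (j - 1) + lam ^ (L - (j - 1)))) / 2 = 0 := by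
  obtain ⟨i, rfl⟩ : ∃ i, j = i + 1 := ⟨j - 1, by omega⟩
  obtain ⟨M, rfl⟩ : ∃ M, L = M + (i + 2) := ⟨L - (i + 2), by omega⟩
  have e1 : M + (i + 2) - (i + 1) = M + 1 := by omega
  have e2 : M + (i + 2) - (i + 1 + 1) = M := by omega
  have e3 : i + 1 - 1 = i := by omega
  have e4 : M + (i + 2) - i = M + 2 := by omega
  rw [e1, e2, e3, e4]
  field_simp
  ring

/-- The source point: `a (1 + λ^L) - (λ + λ^{L-1}) = (1 - λ²)(1 - λ^L)/(2λ)`, `a = (λ + λ⁻¹)/2`,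
`L ≥ 1`. [folklore] -/
theorem cycle_explicit_zero {lam : ℝ} (hl : lam ≠ 0) (hL : 1 ≤ L) :
    (lam + lam⁻¹) / 2 * (lam ^ 0 + lam ^ (L - 0)) -
      ((lam ^ 1 + lam ^ (L - 1)) + (lam ^ (L - 1) + lam ^ 1)) / 2 =
      (1 - lam ^ 2) * (1 - lam ^ L) / (2 * lam) := by
  obtain ⟨M, rfl⟩ : ∃ M, L = M + 1 := ⟨L - 1, by omega⟩
  have e1 : M + 1 - 1 = M := by omega
  rw [Nat.sub_zero, e1]
  field_simp
  ring

/-- The explicit function `g(m) = λ^{m.val} + λ^{L - m.val}` on `ℤ/Lℤ` solves the resolvent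
equation with source `(1 - λ²)(1 - λ^L)/(2λ) · 𝟙(m = 0)`. [folklore] -/
theorem cycle_explicit_resolvent_eq [NeZero L] {lam : ℝ} (hl : lam ≠ 0) (m : ZMod L) :
    (lam + lam⁻¹) / 2 * (lam ^ m.val + lam ^ (L - m.val)) -
      ((lam ^ (m + 1).val + lam ^ (L - (m + 1).val)) +
        (lam ^ (m - 1).val + lam ^ (L - (m - 1).val))) / 2 =
      if m = 0 then (1 - lam ^ 2) * (1 - lam ^ L) / (2 * lam) else 0 := by
  have hL : 1 ≤ L := Nat.one_le_iff_ne_zero.2 (NeZero.ne L)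
  set j := m.val with hj
  have hjL : j < L := ZMod.val_lt m
  have hm : m = (j : ZMod L) := (ZMod.natCast_zmod_val m).symm
  -- the right neighbour
  have hplus : lam ^ (m + 1).val + lam ^ (L - (m + 1).val) = lam ^ (j + 1) + lam ^ (L - (j + 1)) := by
    have hv : (m + 1).val = (j + 1) % L := by
      rw [hm, ← Nat.cast_one, ← Nat.cast_add, ZMod.val_natCast]
    rcases Nat.lt_or_ge (j + 1) L with h | h
    · rw [hv, Nat.mod_eq_of_lt h]
    · have hjL' : j + 1 = L := le_antisymm hjL h
      rw [hv, hjL', Nat.mod_self, Nat.sub_zero, Nat.sub_self, add_comm]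
  rw [hplus]
  rcases Nat.eq_zero_or_pos j with h0 | hpos
  · -- the source point `m = 0`
    have hm0 : m = 0 := by rw [hm, h0, Nat.cast_zero]
    have hminus : lam ^ (m - 1).val + lam ^ (L - (m - 1).val) = lam ^ (L - 1) + lam ^ 1 := by
      have hv : (m - 1).val = L - 1 := by
        have : m - 1 = ((L - 1 : ℕ) : ZMod L) := by
          rw [hm0, Nat.cast_pred (Nat.pos_of_ne_zero (NeZero.ne L)), ZMod.natCast_self]
        rw [this, ZMod.val_natCast, Nat.mod_eq_of_lt (by omega)]
      rw [hv, Nat.sub_sub_self hL]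
    rw [hminus, if_pos hm0, h0, zero_add]
    exact cycle_explicit_zero hl hL
  · -- an interior point
    have hm0 : m ≠ 0 := by
      intro h
      rw [h, ZMod.val_zero] at hj
      omega
    have hminus : lam ^ (m - 1).val + lam ^ (L - (m - 1).val) = lam ^ (j - 1) + lam ^ (L - (j - 1)) := by
      have hv : (m - 1).val = j - 1 := by
        have : m - 1 = ((j - 1 : ℕ) : ZMod L) := by
          rw [hm, Nat.cast_pred hpos]
        rw [this, ZMod.val_natCast, Nat.mod_eq_of_lt (by omega)]
      rw [hv]
    rw [hminus, if_neg hm0]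
    exact cycle_explicit_interior hl hpos hjL

/-! ### The resolvent identity -/

/-- **The resolvent of the cycle in character form**: for `0 < λ < 1`, `a = (λ + λ⁻¹)/2` and every
`m ∈ ℤ/Lℤ`,
`∑_k Re e(km/L) / (a - Re e(k/L)) = L · 2λ (λ^{m.val} + λ^{L-m.val}) / ((1 - λ²)(1 - λ^L))`.
Proof: both sides solve the same resolvent equation (`cycle_charSum_resolvent_eq`,
`cycle_explicit_resolvent_eq`), whose solution is unique by the maximum principle
(`eq_zero_of_cycle_harmonic`). [folklore] -/
theorem cycle_charSum_resolvent [NeZero L] {lam : ℝ} (hl0 : 0 < lam) (hl1 : lam < 1) (m : ZMod L) :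
    ∑ k : ZMod L, ((ZMod.stdAddChar (k * m) : ℂ)).re /
        ((lam + lam⁻¹) / 2 - ((ZMod.stdAddChar k : ℂ)).re) =
      L * (2 * lam * (lam ^ m.val + lam ^ (L - m.val)) / ((1 - lam ^ 2) * (1 - lam ^ L))) := by
  set a : ℝ := (lam + lam⁻¹) / 2 with ha_def
  have ha : 1 < a := by
    rw [ha_def]
    have h1 : 0 < 1 - lam := by linarith
    have : lam + lam⁻¹ > 2 := by
      have : lam⁻¹ = 1 / lam := (one_div lam).symm
      rw [this, gt_iff_lt, ← sub_pos]
      have e : lam + 1 / lam - 2 = (1 - lam) ^ 2 / lam := by field_simp; ring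
      rw [e]; positivity
    linarith
  set κ : ℝ := (1 - lam ^ 2) * (1 - lam ^ L) / (2 * lam) with hκ
  have hκ0 : 0 < κ := by
    have h1 : 0 < 1 - lam ^ 2 := by nlinarith
    have h2 : 0 < 1 - lam ^ L := by
      have : lam ^ L < 1 := pow_lt_one₀ hl0.le hl1 (NeZero.ne L)
      linarith
    positivity
  set r : ZMod L → ℝ := fun m => ∑ k : ZMod L, ((ZMod.stdAddChar (k * m) : ℂ)).re /
      (a - ((ZMod.stdAddChar k : ℂ)).re) with hr
  set g : ZMod L → ℝ := fun m => lam ^ m.val + lam ^ (L - m.val) with hg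
  have hu : ∀ m', a * (κ * r m' - L * g m') =
      ((κ * r (m' + 1) - L * g (m' + 1)) + (κ * r (m' - 1) - L * g (m' - 1))) / 2 := by
    intro m'
    have h1 := cycle_charSum_resolvent_eq ha m'
    have h2 := cycle_explicit_resolvent_eq hl0.ne' m' (L := L)
    simp only [hr, hg]
    rw [← ha_def] at h2
    split_ifs at h1 h2 with h0
    · linear_combination κ * h1 - (L : ℝ) * h2
    · linear_combination κ * h1 - (L : ℝ) * h2
  have h0 := eq_zero_of_cycle_harmonic ha (fun m' => κ * r m' - L * g m') hu m
  have : r m = L * g m / κ := by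
    field_simp
    linarith
  simp only [hr, hg, hκ] at this
  rw [this]
  field_simp

/-- **The resolvent (lattice Green function with mass) of the cycle `ℤ/Lℤ`**, cosine form: for
`0 < λ < 1` and `0 ≤ n ≤ L`,
`∑_{k ∈ ℤ/Lℤ} cos(2πkn/L) / ((λ + λ⁻¹)/2 - cos(2πk/L)) = L · 2λ (λ^n + λ^{L-n}) / ((1 - λ²)(1 - λ^L))`
— the method of images for the two-sided geometric kernel `λ^{|n|}`, i.e. the covariance of the
Gaussian chain / massive lattice propagator on a periodic interval (transfer-matrix evaluation).
[folklore] -/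
theorem sum_cos_div_sub_cos_cycle [NeZero L] {lam : ℝ} (hl0 : 0 < lam) (hl1 : lam < 1) {n : ℕ}
    (hn : n ≤ L) :
    ∑ k : ZMod L, Real.cos (2 * π * (k.val : ℝ) / L * n) /
        ((lam + lam⁻¹) / 2 - Real.cos (2 * π * (k.val : ℝ) / L)) =
      L * (2 * lam * (lam ^ n + lam ^ (L - n)) / ((1 - lam ^ 2) * (1 - lam ^ L))) := by
  have h := cycle_charSum_resolvent hl0 hl1 (n : ZMod L) (L := L)
  simp_rw [stdAddChar_mul_natCast_re, stdAddChar_re] at h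
  rw [h, ZMod.val_natCast]
  rcases hn.lt_or_eq with h1 | h1
  · rw [Nat.mod_eq_of_lt h1]
  · rw [h1, Nat.mod_self, Nat.sub_zero, Nat.sub_self, add_comm]

/-! ### The mass parameter `λ = a - √(a² - 1)` -/

/-- For `a > 1`, `λ = a - √(a² - 1)` lies in `(0, 1)` and `(λ + λ⁻¹)/2 = a`; moreover
`2λ/(1 - λ²) = 1/√(a² - 1)`. [folklore] -/
theorem massParam_spec {a : ℝ} (ha : 1 < a) :
    0 < a - Real.sqrt (a ^ 2 - 1) ∧ a - Real.sqrt (a ^ 2 - 1) < 1 ∧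
      ((a - Real.sqrt (a ^ 2 - 1)) + (a - Real.sqrt (a ^ 2 - 1))⁻¹) / 2 = a ∧
      2 * (a - Real.sqrt (a ^ 2 - 1)) / (1 - (a - Real.sqrt (a ^ 2 - 1)) ^ 2) =
        1 / Real.sqrt (a ^ 2 - 1) := by
  set s := Real.sqrt (a ^ 2 - 1) with hs
  have hs0 : 0 < s := Real.sqrt_pos.2 (by nlinarith)
  have hs2 : s ^ 2 = a ^ 2 - 1 := Real.sq_sqrt (by nlinarith)
  have hprod : (a - s) * (a + s) = 1 := by nlinarith
  have hpos : 0 < a + s := by linarith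
  have hlam : a - s = (a + s)⁻¹ := by
    exact eq_inv_of_mul_eq_one_left hprod
  have hl0 : 0 < a - s := by rw [hlam]; positivity
  refine ⟨hl0, ?_, ?_, ?_⟩
  · rw [hlam]
    exact inv_lt_one_of_one_lt₀ (by linarith)
  · rw [hlam, inv_inv]
    field_simp
    linarith [hs2]
  · have h1 : 1 - (a - s) ^ 2 = 2 * s * (a - s) := by nlinarith
    rw [h1]
    field_simp

/-- Upper bound on the mass parameter: `λ ≤ 1/(1 + √(a² - 1))` (`a ≥ 1`). [folklore] -/
theorem massParam_le {a : ℝ} (ha : 1 < a) :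
    a - Real.sqrt (a ^ 2 - 1) ≤ 1 / (1 + Real.sqrt (a ^ 2 - 1)) := by
  set s := Real.sqrt (a ^ 2 - 1) with hs
  have hs0 : 0 < s := Real.sqrt_pos.2 (by nlinarith)
  have hs2 : s ^ 2 = a ^ 2 - 1 := Real.sq_sqrt (by nlinarith)
  have hprod : (a - s) * (a + s) = 1 := by nlinarith
  rw [le_div_iff₀ (by positivity)]
  nlinarith

/-- Lower bound on the mass parameter: `exp(-((a - 1) + √(a² - 1))) ≤ λ`, from
`λ = 1/(a + √(a² - 1))` and `1 + x ≤ eˣ`. [folklore] -/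
theorem exp_neg_le_massParam {a : ℝ} (ha : 1 < a) :
    Real.exp (-((a - 1) + Real.sqrt (a ^ 2 - 1))) ≤ a - Real.sqrt (a ^ 2 - 1) := by
  set s := Real.sqrt (a ^ 2 - 1) with hs
  have hs0 : 0 < s := Real.sqrt_pos.2 (by nlinarith)
  have hs2 : s ^ 2 = a ^ 2 - 1 := Real.sq_sqrt (by nlinarith)
  have hprod : (a - s) * (a + s) = 1 := by nlinarith
  have hpos : 0 < a + s := by linarith
  have hlam : a - s = (a + s)⁻¹ := by
    exact eq_inv_of_mul_eq_one_left hprod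
  rw [hlam, Real.exp_neg]
  refine inv_anti₀ hpos ?_
  have := Real.add_one_le_exp ((a - 1) + s)
  linarith

end Literature.Probability.LatticeModels

end
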